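import Literature.Analysis.ODE.BarrierTwoPoint
import HarnessLib

/-!
# Two flux-carrying complex solutions across a deep barrier: flux floors at both ends,
# dominance of the growing components in the Wronskian, and the two-point bounds

Topic `Literature/Analysis/ODE` (namespace `Literature.Analysis.ODE`), continuing
`BarrierTwoPoint.lean` (`barrier_two_point`: representations `u = a_u g + b_u d`,
`v = a_v g + b_v d` over the monotone two-end real basis of `y″ = q y` on `[α, β]`, the Wronskian
factorisation `u v′ − u′ v ≡ −(a_u b_v − b_u a_v) w₀`, the four-term bound, the flux ceilings and the
floor `(|a_u||b_v| − |b_u||a_v|) w₀ ≤ |W|`) and `RecessiveDominance.lean` (ONE solution known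
through its end data and flux). Here BOTH solutions are known only through ONE-SIDED data: `u`
through a bound `‖u′(α)‖ ≤ P₁` and its flux `Im(ū u′)(α) = F_u ≠ 0` at the LEFT end (think: the
horizon-normalised solution of a radial wave equation entering the barrier from a cap where it
oscillates), `v` through `‖v′(β)‖ ≤ Q₁` and `Im(v̄ v′)(β) = F_v ≠ 0` at the RIGHT end (the
infinity-normalised solution). No relation between the signs of `F_u`, `F_v` is assumed — this is
the regime (superradiant frequencies) where the flux pairing of `KernelPairing.lean` is void and a
lower bound for the Wronskian must come from TUNNELLING:

* `barrier_coeff_bounds` — `‖b_u‖ w₀ = ‖u′(α)‖ ≤ P₁`, `‖a_v‖ w₀ = ‖v′(β)‖ ≤ Q₁` (the components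
  growing AWAY from the data end are read off the derivative there) and the flux floors
  `|F_u| ≤ ‖a_u‖ P₁`, `|F_v| ≤ ‖b_v‖ Q₁` (a flux-carrying solution cannot cancel its component
  growing INTO the barrier); in particular `P₁, Q₁, ‖a_u‖, ‖b_v‖ > 0`;
* `barrier_dominance` — under the DEPTH condition `2 P₁² Q₁² ≤ |F_u| |F_v| w₀²` (`w₀ = g′(β)` is
  the product of a growth factor and a rate across `[α, β]`): `‖b_u‖‖a_v‖ ≤ ½ ‖a_u‖‖b_v‖`, hence
  `‖a_u b_v − b_u a_v‖ ≥ ½ ‖a_u‖‖b_v‖` and the WRONSKIAN FLOOR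
  `|F_u||F_v| w₀ / (2 P₁ Q₁) ≤ ‖u v′ − v u′‖` on `[α, β]` — an exponentially large lower bound,
  i.e. quantitative absence of modes, from depth alone;
* `barrier_two_point_of_dominance` — the resulting two-point bounds with `‖W‖` factored out:
  for `α ≤ x ≤ x′ ≤ β`,
  `‖u x‖‖v x′‖ ≤ ‖W‖·(2Q₁² g(x′)²/(|F_v| w₀²) + 2 g(x′)d(x′)/w₀ + 2P₁²Q₁² d(α)g(β)/(|F_u||F_v| w₀³)
  + 2P₁² d(x)²/(|F_u| w₀²))`, the one-point envelopes
  `‖v x′‖ ≤ ‖W‖·(2P₁Q₁² g(x′)/(|F_u||F_v| w₀²) + 2P₁ d(x′)/(|F_u| w₀))`,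
  `‖u x‖ ≤ ‖W‖·(2Q₁ g(x)/(|F_v| w₀) + 2P₁²Q₁ d(x)/(|F_u||F_v| w₀²))` (for pairs with one point
  outside `[α, β]`), and `1 ≤ ‖W‖·2P₁Q₁/(|F_u||F_v| w₀)` (pairs straddling the barrier).
  Every coefficient is a ratio of end data, `1/w₀` and values of `g, d`; turning them into rates
  (`d(α)/w₀ = 1/r_α`, `g(β)/w₀ = 1/r_β`, `g d/w₀ = 1/(r_g + r_d)`) is left to the user.

Everything is one-interval algebra on top of `barrier_two_point`; all proved. Used for the cone
Green-kernel bound of Carter's radial equation in the Breitenlohner–Freedman-stable superradiant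
sectors of the near-extremal Kerr programme (the depth is certified there, not here).

## References
* P. Hartman, *Ordinary Differential Equations* (SIAM Classics 38, 2002), Ch. XI §2 (Wronskian
  identities) and §6 (disconjugacy, principal solutions). Key `Hartman2002`.
* M. V. Berry, K. E. Mount, Rep. Prog. Phys. 35 (1972) 315, §3 (tunnelling through a barrier:
  the transmitted amplitude is the reciprocal of the growth factor). The algebra is folklore.
-/

noncomputable section

open Set
open scoped ComplexConjugate

namespace Literature.Analysis.ODE

/-- `‖z / w₀‖ = ‖z‖ / w₀` and `‖-z / w₀‖ = ‖z‖ / w₀` for real `w₀ > 0`. [folklore] -/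
theorem norm_div_ofReal_of_pos (z : ℂ) {w₀ : ℝ} (hw₀ : 0 < w₀) :
    ‖z / (w₀ : ℂ)‖ = ‖z‖ / w₀ ∧ ‖-z / (w₀ : ℂ)‖ = ‖z‖ / w₀ := by
  rw [norm_div, norm_div, norm_neg, Complex.norm_of_nonneg hw₀.le]
  exact ⟨rfl, rfl⟩

/-- **End-data and flux bounds for the barrier coefficients.** In the setting of
`barrier_two_point` (monotone two-end basis `g, d` of `y″ = q y` on `[α, β]`, `w₀ = g′(β) > 0`,
complex solutions `u = a_u g + b_u d`, `v = a_v g + b_v d` with `b_u = −u′(α)/w₀`,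
`a_u = u(α) − b_u d(α)`, `a_v = v′(β)/w₀`, `b_v = v(β) − a_v g(β)`), suppose `‖u′(α)‖ ≤ P₁`,
`‖v′(β)‖ ≤ Q₁` and the fluxes `Im(ū u′)(α) = F_u ≠ 0`, `Im(v̄ v′)(β) = F_v ≠ 0`. Then
`‖b_u‖ w₀ ≤ P₁`, `‖a_v‖ w₀ ≤ Q₁`, `|F_u| ≤ ‖a_u‖ P₁`, `|F_v| ≤ ‖b_v‖ Q₁`, and
`0 < P₁`, `0 < Q₁`, `0 < ‖a_u‖`, `0 < ‖b_v‖`. [folklore] -/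
theorem barrier_coeff_bounds {q g g' d d' : ℝ → ℝ} {u u' v v' : ℝ → ℂ} {α β w₀ : ℝ}
    (hαβ : α ≤ β) (hw₀ : 0 < w₀)
    (hg : ∀ x ∈ Icc α β, HasDerivAt g (g' x) x ∧ HasDerivAt g' (q x * g x) x)
    (hd : ∀ x ∈ Icc α β, HasDerivAt d (d' x) x ∧ HasDerivAt d' (q x * d x) x)
    (hgα : g α = 1) (hg'α : g' α = 0) (hdβ : d β = 1) (hd'β : d' β = 0) (hg'β : g' β = w₀)
    (hsign : ∀ x ∈ Icc α β, 1 ≤ g x ∧ 0 ≤ g' x ∧ 1 ≤ d x ∧ d' x ≤ 0)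
    (hgm : MonotoneOn g (Icc α β)) (hdm : AntitoneOn d (Icc α β))
    (hW : ∀ x ∈ Icc α β, g x * d' x - g' x * d x = -w₀)
    (hu : ∀ x ∈ Icc α β, HasDerivAt u (u' x) x ∧ HasDerivAt u' ((q x : ℂ) * u x) x)
    (hv : ∀ x ∈ Icc α β, HasDerivAt v (v' x) x ∧ HasDerivAt v' ((q x : ℂ) * v x) x)
    (au bu av bv : ℂ) (hbu : bu = -u' α / w₀) (hau : au = u α - bu * d α)
    (hav : av = v' β / w₀) (hbv : bv = v β - av * g β)
    {Fu Fv P₁ Q₁ : ℝ} (hFu : (conj (u α) * u' α).im = Fu) (hFv : (conj (v β) * v' β).im = Fv)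
    (hFu0 : Fu ≠ 0) (hFv0 : Fv ≠ 0) (hP₁ : ‖u' α‖ ≤ P₁) (hQ₁ : ‖v' β‖ ≤ Q₁) :
    ‖bu‖ * w₀ ≤ P₁ ∧ ‖av‖ * w₀ ≤ Q₁ ∧ |Fu| ≤ ‖au‖ * P₁ ∧ |Fv| ≤ ‖bv‖ * Q₁ ∧
      0 < P₁ ∧ 0 < Q₁ ∧ 0 < ‖au‖ ∧ 0 < ‖bv‖ := by
  obtain ⟨-, -, -, -, h5, h6, -⟩ := barrier_two_point hαβ hw₀ hg hd hgα hg'α hdβ hd'β hg'β hsign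
    hgm hdm hW hu hv au bu av bv hbu hau hav hbv
  rw [hFu] at h5
  rw [hFv] at h6
  -- the components growing away from the data ends
  have hbu' : ‖bu‖ * w₀ = ‖u' α‖ := by
    rw [hbu, (norm_div_ofReal_of_pos (u' α) hw₀).2, div_mul_cancel₀ _ hw₀.ne']
  have hav' : ‖av‖ * w₀ = ‖v' β‖ := by
    rw [hav, (norm_div_ofReal_of_pos (v' β) hw₀).1, div_mul_cancel₀ _ hw₀.ne']
  have h1 : ‖bu‖ * w₀ ≤ P₁ := hbu'.le.trans hP₁
  have h2 : ‖av‖ * w₀ ≤ Q₁ := hav'.le.trans hQ₁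
  -- the flux floors
  have h3 : |Fu| ≤ ‖au‖ * P₁ := by
    calc |Fu| ≤ ‖au‖ * ‖bu‖ * w₀ := h5
      _ = ‖au‖ * (‖bu‖ * w₀) := by ring
      _ ≤ ‖au‖ * P₁ := mul_le_mul_of_nonneg_left h1 (norm_nonneg _)
  have h4 : |Fv| ≤ ‖bv‖ * Q₁ := by
    calc |Fv| ≤ ‖av‖ * ‖bv‖ * w₀ := h6
      _ = ‖bv‖ * (‖av‖ * w₀) := by ring
      _ ≤ ‖bv‖ * Q₁ := mul_le_mul_of_nonneg_left h2 (norm_nonneg _)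
  -- positivity of the data
  have hFu' : 0 < |Fu| := abs_pos.2 hFu0
  have hFv' : 0 < |Fv| := abs_pos.2 hFv0
  have hP₁0 : 0 < P₁ := by
    have hne : u' α ≠ 0 := by
      intro e; rw [e, mul_zero, Complex.zero_im] at hFu; exact hFu0 hFu.symm
    exact (norm_pos_iff.2 hne).trans_le hP₁
  have hQ₁0 : 0 < Q₁ := by
    have hne : v' β ≠ 0 := by
      intro e; rw [e, mul_zero, Complex.zero_im] at hFv; exact hFv0 hFv.symm
    exact (norm_pos_iff.2 hne).trans_le hQ₁
  have hau0 : 0 < ‖au‖ := by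
    by_contra h0
    have : ‖au‖ = 0 := le_antisymm (not_lt.1 h0) (norm_nonneg _)
    rw [this, zero_mul] at h3
    exact absurd h3 (not_le.2 hFu')
  have hbv0 : 0 < ‖bv‖ := by
    by_contra h0
    have : ‖bv‖ = 0 := le_antisymm (not_lt.1 h0) (norm_nonneg _)
    rw [this, zero_mul] at h4
    exact absurd h4 (not_le.2 hFv')
  exact ⟨h1, h2, h3, h4, hP₁0, hQ₁0, hau0, hbv0⟩

/-- **Dominance and the Wronskian floor from depth.** In the setting of `barrier_coeff_bounds`,
assume the barrier is DEEP: `2 P₁² Q₁² ≤ |F_u| |F_v| w₀²`. Then the away-growing components are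
dominated, `‖b_u‖‖a_v‖ ≤ ½ ‖a_u‖‖b_v‖`, so `½ ‖a_u‖‖b_v‖ ≤ ‖a_u b_v − b_u a_v‖`, and at every
`x ∈ [α, β]` the Wronskian `W = u v′ − v u′` satisfies `‖W(x)‖ = ‖a_u b_v − b_u a_v‖ w₀` and the floor
`|F_u| |F_v| w₀ / (2 P₁ Q₁) ≤ ‖W(x)‖`. [folklore] -/
theorem barrier_dominance {q g g' d d' : ℝ → ℝ} {u u' v v' : ℝ → ℂ} {α β w₀ : ℝ}
    (hαβ : α ≤ β) (hw₀ : 0 < w₀)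
    (hg : ∀ x ∈ Icc α β, HasDerivAt g (g' x) x ∧ HasDerivAt g' (q x * g x) x)
    (hd : ∀ x ∈ Icc α β, HasDerivAt d (d' x) x ∧ HasDerivAt d' (q x * d x) x)
    (hgα : g α = 1) (hg'α : g' α = 0) (hdβ : d β = 1) (hd'β : d' β = 0) (hg'β : g' β = w₀)
    (hsign : ∀ x ∈ Icc α β, 1 ≤ g x ∧ 0 ≤ g' x ∧ 1 ≤ d x ∧ d' x ≤ 0)
    (hgm : MonotoneOn g (Icc α β)) (hdm : AntitoneOn d (Icc α β))
    (hW : ∀ x ∈ Icc α β, g x * d' x - g' x * d x = -w₀)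
    (hu : ∀ x ∈ Icc α β, HasDerivAt u (u' x) x ∧ HasDerivAt u' ((q x : ℂ) * u x) x)
    (hv : ∀ x ∈ Icc α β, HasDerivAt v (v' x) x ∧ HasDerivAt v' ((q x : ℂ) * v x) x)
    (au bu av bv : ℂ) (hbu : bu = -u' α / w₀) (hau : au = u α - bu * d α)
    (hav : av = v' β / w₀) (hbv : bv = v β - av * g β)
    {Fu Fv P₁ Q₁ : ℝ} (hFu : (conj (u α) * u' α).im = Fu) (hFv : (conj (v β) * v' β).im = Fv)
    (hFu0 : Fu ≠ 0) (hFv0 : Fv ≠ 0) (hP₁ : ‖u' α‖ ≤ P₁) (hQ₁ : ‖v' β‖ ≤ Q₁)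
    (hdeep : 2 * P₁ ^ 2 * Q₁ ^ 2 ≤ |Fu| * |Fv| * w₀ ^ 2) :
    ‖bu‖ * ‖av‖ ≤ 1 / 2 * (‖au‖ * ‖bv‖) ∧ 1 / 2 * (‖au‖ * ‖bv‖) ≤ ‖au * bv - bu * av‖ ∧
      ∀ x ∈ Icc α β, ‖u x * v' x - v x * u' x‖ = ‖au * bv - bu * av‖ * w₀ ∧
        |Fu| * |Fv| * w₀ / (2 * P₁ * Q₁) ≤ ‖u x * v' x - v x * u' x‖ := by
  obtain ⟨-, -, h3, -, -, -, -⟩ := barrier_two_point hαβ hw₀ hg hd hgα hg'α hdβ hd'β hg'β hsign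
    hgm hdm hW hu hv au bu av bv hbu hau hav hbv
  obtain ⟨hB, hC, hA, hD, hP₁0, hQ₁0, hau0, hbv0⟩ := barrier_coeff_bounds hαβ hw₀ hg hd hgα hg'α
    hdβ hd'β hg'β hsign hgm hdm hW hu hv au bu av bv hbu hau hav hbv hFu hFv hFu0 hFv0 hP₁ hQ₁
  set A := ‖au‖ with hAdef
  set B := ‖bu‖ with hBdef
  set C := ‖av‖ with hCdef
  set D := ‖bv‖ with hDdef
  have hB0 : 0 ≤ B := norm_nonneg _
  have hC0 : 0 ≤ C := norm_nonneg _
  -- `B C w₀² ≤ P₁ Q₁` and `|F_u||F_v| ≤ A D P₁ Q₁`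
  have e1 : B * C * w₀ ^ 2 ≤ P₁ * Q₁ := by
    calc B * C * w₀ ^ 2 = (B * w₀) * (C * w₀) := by ring
      _ ≤ P₁ * Q₁ := mul_le_mul hB hC (by positivity) hP₁0.le
  have e2 : |Fu| * |Fv| ≤ A * D * (P₁ * Q₁) := by
    calc |Fu| * |Fv| ≤ (A * P₁) * (D * Q₁) := mul_le_mul hA hD (abs_nonneg _) (by positivity)
      _ = A * D * (P₁ * Q₁) := by ring
  -- dominance
  have hdom : B * C ≤ 1 / 2 * (A * D) := by
    have hPQ : 0 < P₁ * Q₁ * w₀ ^ 2 := by positivity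
    have key : B * C * (P₁ * Q₁ * w₀ ^ 2) ≤ 1 / 2 * (A * D) * (P₁ * Q₁ * w₀ ^ 2) := by
      calc B * C * (P₁ * Q₁ * w₀ ^ 2) = (B * C * w₀ ^ 2) * (P₁ * Q₁) := by ring
        _ ≤ (P₁ * Q₁) * (P₁ * Q₁) := mul_le_mul_of_nonneg_right e1 (by positivity)
        _ = 1 / 2 * (2 * P₁ ^ 2 * Q₁ ^ 2) := by ring
        _ ≤ 1 / 2 * (|Fu| * |Fv| * w₀ ^ 2) := by linarith
        _ ≤ 1 / 2 * (A * D * (P₁ * Q₁) * w₀ ^ 2) := by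
            have := mul_le_mul_of_nonneg_right e2 (sq_nonneg w₀)
            linarith
        _ = 1 / 2 * (A * D) * (P₁ * Q₁ * w₀ ^ 2) := by ring
    exact le_of_mul_le_mul_right key hPQ
  have hdet : 1 / 2 * (A * D) ≤ ‖au * bv - bu * av‖ := by
    have h := norm_sub_norm_le (au * bv) (bu * av)
    rw [norm_mul, norm_mul] at h
    linarith
  refine ⟨hdom, hdet, fun x hx ↦ ?_⟩
  have hWx : ‖u x * v' x - v x * u' x‖ = ‖au * bv - bu * av‖ * w₀ := by
    rw [show u x * v' x - v x * u' x = u x * v' x - u' x * v x by ring, h3 x hx, norm_mul,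
      norm_neg, Complex.norm_of_nonneg hw₀.le]
  refine ⟨hWx, ?_⟩
  rw [hWx, div_le_iff₀ (by positivity)]
  calc |Fu| * |Fv| * w₀ ≤ A * D * (P₁ * Q₁) * w₀ := mul_le_mul_of_nonneg_right e2 hw₀.le
    _ = 1 / 2 * (A * D) * w₀ * (2 * P₁ * Q₁) := by ring
    _ ≤ ‖au * bv - bu * av‖ * w₀ * (2 * P₁ * Q₁) := by gcongr

/-- **Two-point bounds across a deep barrier with the Wronskian factored out.** In the setting of
`barrier_dominance` (depth `2P₁²Q₁² ≤ |F_u||F_v| w₀²`), writing `‖W‖` for the (constant) norm of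
the Wronskian `u v′ − v u′` on `[α, β]`, evaluated at `α`:
(1) for `α ≤ x ≤ x′ ≤ β`,
`‖u x‖‖v x′‖ ≤ ‖W‖·(2Q₁² g(x′)²/(|F_v| w₀²) + 2 g(x′)d(x′)/w₀ + 2P₁²Q₁² d(α)g(β)/(|F_u||F_v| w₀³)
 + 2P₁² d(x)²/(|F_u| w₀²))`;
(2) for `x′ ∈ [α, β]`, `‖v x′‖ ≤ ‖W‖·(2P₁Q₁² g(x′)/(|F_u||F_v| w₀²) + 2P₁ d(x′)/(|F_u| w₀))`;
(3) for `x ∈ [α, β]`, `‖u x‖ ≤ ‖W‖·(2Q₁ g(x)/(|F_v| w₀) + 2P₁²Q₁ d(x)/(|F_u||F_v| w₀²))`;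
(4) `1 ≤ ‖W‖·2P₁Q₁/(|F_u||F_v| w₀)`.
With (2)–(4) the pairs having one or both points outside `[α, β]` reduce to envelopes of `u`
before `α` and of `v` after `β`. [folklore] -/
theorem barrier_two_point_of_dominance {q g g' d d' : ℝ → ℝ} {u u' v v' : ℝ → ℂ} {α β w₀ : ℝ}
    (hαβ : α ≤ β) (hw₀ : 0 < w₀)
    (hg : ∀ x ∈ Icc α β, HasDerivAt g (g' x) x ∧ HasDerivAt g' (q x * g x) x)
    (hd : ∀ x ∈ Icc α β, HasDerivAt d (d' x) x ∧ HasDerivAt d' (q x * d x) x)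
    (hgα : g α = 1) (hg'α : g' α = 0) (hdβ : d β = 1) (hd'β : d' β = 0) (hg'β : g' β = w₀)
    (hsign : ∀ x ∈ Icc α β, 1 ≤ g x ∧ 0 ≤ g' x ∧ 1 ≤ d x ∧ d' x ≤ 0)
    (hgm : MonotoneOn g (Icc α β)) (hdm : AntitoneOn d (Icc α β))
    (hW : ∀ x ∈ Icc α β, g x * d' x - g' x * d x = -w₀)
    (hu : ∀ x ∈ Icc α β, HasDerivAt u (u' x) x ∧ HasDerivAt u' ((q x : ℂ) * u x) x)
    (hv : ∀ x ∈ Icc α β, HasDerivAt v (v' x) x ∧ HasDerivAt v' ((q x : ℂ) * v x) x)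
    {Fu Fv P₁ Q₁ : ℝ} (hFu : (conj (u α) * u' α).im = Fu) (hFv : (conj (v β) * v' β).im = Fv)
    (hFu0 : Fu ≠ 0) (hFv0 : Fv ≠ 0) (hP₁ : ‖u' α‖ ≤ P₁) (hQ₁ : ‖v' β‖ ≤ Q₁)
    (hdeep : 2 * P₁ ^ 2 * Q₁ ^ 2 ≤ |Fu| * |Fv| * w₀ ^ 2) :
    (∀ x ∈ Icc α β, ∀ x' ∈ Icc α β, x ≤ x' →
      ‖u x‖ * ‖v x'‖ ≤ ‖u α * v' α - v α * u' α‖ *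
        (2 * Q₁ ^ 2 * g x' ^ 2 / (|Fv| * w₀ ^ 2) + 2 * (g x' * d x') / w₀ +
          2 * P₁ ^ 2 * Q₁ ^ 2 * (d α * g β) / (|Fu| * |Fv| * w₀ ^ 3) +
          2 * P₁ ^ 2 * d x ^ 2 / (|Fu| * w₀ ^ 2))) ∧
    (∀ x' ∈ Icc α β, ‖v x'‖ ≤ ‖u α * v' α - v α * u' α‖ *
        (2 * P₁ * Q₁ ^ 2 * g x' / (|Fu| * |Fv| * w₀ ^ 2) + 2 * P₁ * d x' / (|Fu| * w₀))) ∧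
    (∀ x ∈ Icc α β, ‖u x‖ ≤ ‖u α * v' α - v α * u' α‖ *
        (2 * Q₁ * g x / (|Fv| * w₀) + 2 * P₁ ^ 2 * Q₁ * d x / (|Fu| * |Fv| * w₀ ^ 2))) ∧
    1 ≤ ‖u α * v' α - v α * u' α‖ * (2 * P₁ * Q₁ / (|Fu| * |Fv| * w₀)) := by
  have hα : α ∈ Icc α β := left_mem_Icc.2 hαβ
  -- the coefficients and the facts about them
  set bu : ℂ := -u' α / w₀ with hbu
  set au : ℂ := u α - bu * d α with hau
  set av : ℂ := v' β / w₀ with hav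
  set bv : ℂ := v β - av * g β with hbv
  obtain ⟨hU, hV, -, h4, -, -, -⟩ := barrier_two_point hαβ hw₀ hg hd hgα hg'α hdβ hd'β hg'β hsign
    hgm hdm hW hu hv au bu av bv hbu hau hav hbv
  obtain ⟨hB, hC, hA, hD, hP₁0, hQ₁0, hau0, hbv0⟩ := barrier_coeff_bounds hαβ hw₀ hg hd hgα hg'α
    hdβ hd'β hg'β hsign hgm hdm hW hu hv au bu av bv hbu hau hav hbv hFu hFv hFu0 hFv0 hP₁ hQ₁
  obtain ⟨hdom, hdet, hWx⟩ := barrier_dominance hαβ hw₀ hg hd hgα hg'α hdβ hd'β hg'β hsign hgm hdm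
    hW hu hv au bu av bv hbu hau hav hbv hFu hFv hFu0 hFv0 hP₁ hQ₁ hdeep
  obtain ⟨hWα, hfloor⟩ := hWx α hα
  set A := ‖au‖ with hAdef
  set B := ‖bu‖ with hBdef
  set C := ‖av‖ with hCdef
  set D := ‖bv‖ with hDdef
  set Wn := ‖u α * v' α - v α * u' α‖ with hWn
  clear_value au bu av bv
  have hB0 : 0 ≤ B := norm_nonneg _
  have hC0 : 0 ≤ C := norm_nonneg _
  have hFu' : 0 < |Fu| := abs_pos.2 hFu0
  have hFv' : 0 < |Fv| := abs_pos.2 hFv0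
  have hWn0 : 0 < Wn := lt_of_lt_of_le (by positivity) hfloor
  -- `½ A D w₀ ≤ Wn`
  have hADW : 1 / 2 * (A * D) * w₀ ≤ Wn := by
    rw [hWα]; exact mul_le_mul_of_nonneg_right hdet hw₀.le
  -- scalar consequences: `A ≤ Wn·2Q₁/(|F_v|w₀)`, `D ≤ Wn·2P₁/(|F_u|w₀)`, `B ≤ P₁/w₀`, `C ≤ Q₁/w₀`
  have hAle : A ≤ Wn * (2 * Q₁ / (|Fv| * w₀)) := by
    rw [mul_div_assoc', le_div_iff₀ (by positivity)]
    calc A * (|Fv| * w₀) ≤ A * (D * Q₁ * w₀) := by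
          apply mul_le_mul_of_nonneg_left _ hau0.le
          exact mul_le_mul_of_nonneg_right hD hw₀.le
      _ = 1 / 2 * (A * D) * w₀ * (2 * Q₁) := by ring
      _ ≤ Wn * (2 * Q₁) := mul_le_mul_of_nonneg_right hADW (by positivity)
  have hDle : D ≤ Wn * (2 * P₁ / (|Fu| * w₀)) := by
    rw [mul_div_assoc', le_div_iff₀ (by positivity)]
    calc D * (|Fu| * w₀) ≤ D * (A * P₁ * w₀) := by
          apply mul_le_mul_of_nonneg_left _ hbv0.le
          exact mul_le_mul_of_nonneg_right hA hw₀.le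
      _ = 1 / 2 * (A * D) * w₀ * (2 * P₁) := by ring
      _ ≤ Wn * (2 * P₁) := mul_le_mul_of_nonneg_right hADW (by positivity)
  have hBle : B ≤ P₁ / w₀ := by rw [le_div_iff₀ hw₀]; exact hB
  have hCle : C ≤ Q₁ / w₀ := by rw [le_div_iff₀ hw₀]; exact hC
  -- (4): `1 ≤ Wn·2P₁Q₁/(|F_u||F_v|w₀)`
  have h4' : 1 ≤ Wn * (2 * P₁ * Q₁ / (|Fu| * |Fv| * w₀)) := by
    rw [mul_div_assoc', le_div_iff₀ (by positivity), one_mul]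
    have := hfloor
    rw [div_le_iff₀ (by positivity)] at this
    linarith
  refine ⟨fun x hx x' hx' hxx' ↦ ?_, fun x' hx' ↦ ?_, fun x hx ↦ ?_, h4'⟩
  · -- (1): the four-term bound, term by term
    obtain ⟨hgx', -, hdx', -⟩ := hsign x' hx'
    obtain ⟨-, -, hdx, -⟩ := hsign x hx
    have hg0 : 0 ≤ g x' := by linarith
    have hd0 : 0 ≤ d x' := by linarith
    have key := h4 x hx x' hx' hxx'
    -- term 1: `A C g² ≤ Wn · 2Q₁²g²/(|F_v|w₀²)`
    have t1 : A * C * g x' ^ 2 ≤ Wn * (2 * Q₁ ^ 2 * g x' ^ 2 / (|Fv| * w₀ ^ 2)) := by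
      have hC' : C ≤ Q₁ / w₀ := hCle
      have e : Wn * (2 * Q₁ ^ 2 * g x' ^ 2 / (|Fv| * w₀ ^ 2)) =
          (Wn * (2 * Q₁ / (|Fv| * w₀))) * (Q₁ / w₀) * g x' ^ 2 := by
        field_simp
      rw [e]
      have : A * C ≤ (Wn * (2 * Q₁ / (|Fv| * w₀))) * (Q₁ / w₀) :=
        mul_le_mul hAle hC' hC0 (by positivity)
      exact mul_le_mul_of_nonneg_right this (sq_nonneg _)
    -- term 2: `A D g d ≤ Wn · 2 g d/w₀`
    have t2 : A * D * (g x' * d x') ≤ Wn * (2 * (g x' * d x') / w₀) := by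
      have e : Wn * (2 * (g x' * d x') / w₀) = (Wn * (2 / w₀)) * (g x' * d x') := by ring
      rw [e]
      refine mul_le_mul_of_nonneg_right ?_ (mul_nonneg hg0 hd0)
      rw [mul_div_assoc', le_div_iff₀ hw₀]
      linarith
    -- term 3: `B C d(α) g(β) ≤ Wn · 2P₁²Q₁² d(α)g(β)/(|F_u||F_v|w₀³)`
    have t3 : B * C * (d α * g β) ≤
        Wn * (2 * P₁ ^ 2 * Q₁ ^ 2 * (d α * g β) / (|Fu| * |Fv| * w₀ ^ 3)) := by
      have hdg : 0 ≤ d α * g β := by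
        have := (hsign α hα).2.2.1
        have := (hsign β (right_mem_Icc.2 hαβ)).1
        positivity
      have e : Wn * (2 * P₁ ^ 2 * Q₁ ^ 2 * (d α * g β) / (|Fu| * |Fv| * w₀ ^ 3)) =
          (Wn * (2 * P₁ * Q₁ / (|Fu| * |Fv| * w₀))) * ((P₁ / w₀) * (Q₁ / w₀)) * (d α * g β) := by
        field_simp
      rw [e]
      refine mul_le_mul_of_nonneg_right ?_ hdg
      have hBC : B * C ≤ (P₁ / w₀) * (Q₁ / w₀) := mul_le_mul hBle hCle hC0 (by positivity)
      calc B * C = 1 * (B * C) := (one_mul _).symm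
        _ ≤ (Wn * (2 * P₁ * Q₁ / (|Fu| * |Fv| * w₀))) * ((P₁ / w₀) * (Q₁ / w₀)) :=
            mul_le_mul h4' hBC (mul_nonneg hB0 hC0) (by positivity)
    -- term 4: `B D d(x)² ≤ Wn · 2P₁² d(x)²/(|F_u|w₀²)`
    have t4 : B * D * d x ^ 2 ≤ Wn * (2 * P₁ ^ 2 * d x ^ 2 / (|Fu| * w₀ ^ 2)) := by
      have e : Wn * (2 * P₁ ^ 2 * d x ^ 2 / (|Fu| * w₀ ^ 2)) =
          (P₁ / w₀) * (Wn * (2 * P₁ / (|Fu| * w₀))) * d x ^ 2 := by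
        field_simp
      rw [e]
      have : B * D ≤ (P₁ / w₀) * (Wn * (2 * P₁ / (|Fu| * w₀))) :=
        mul_le_mul hBle hDle (norm_nonneg _) (by positivity)
      exact mul_le_mul_of_nonneg_right this (sq_nonneg _)
    calc ‖u x‖ * ‖v x'‖ ≤ A * C * g x' ^ 2 + A * D * (g x' * d x') + B * C * (d α * g β) +
          B * D * d x ^ 2 := key
      _ ≤ _ := by rw [mul_add, mul_add, mul_add]; linarith [t1, t2, t3, t4]
  · -- (2): `v` alone
    obtain ⟨hgx', -, hdx', -⟩ := hsign x' hx'
    have hg0 : 0 ≤ g x' := by linarith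
    have hd0 : 0 ≤ d x' := by linarith
    have hrep : ‖v x'‖ ≤ C * g x' + D * d x' := by
      rw [(hV x' hx').1]; exact norm_mul_ofReal_add_le av bv hg0 hd0
    have t1 : C * g x' ≤ Wn * (2 * P₁ * Q₁ ^ 2 * g x' / (|Fu| * |Fv| * w₀ ^ 2)) := by
      have e : Wn * (2 * P₁ * Q₁ ^ 2 * g x' / (|Fu| * |Fv| * w₀ ^ 2)) =
          (Wn * (2 * P₁ * Q₁ / (|Fu| * |Fv| * w₀))) * (Q₁ / w₀) * g x' := by
        field_simp
      rw [e]
      refine mul_le_mul_of_nonneg_right ?_ hg0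
      calc C = 1 * C := (one_mul _).symm
        _ ≤ (Wn * (2 * P₁ * Q₁ / (|Fu| * |Fv| * w₀))) * (Q₁ / w₀) :=
            mul_le_mul h4' hCle hC0 (by positivity)
    have t2 : D * d x' ≤ Wn * (2 * P₁ * d x' / (|Fu| * w₀)) := by
      have e : Wn * (2 * P₁ * d x' / (|Fu| * w₀)) = (Wn * (2 * P₁ / (|Fu| * w₀))) * d x' := by
        field_simp
      rw [e]
      exact mul_le_mul_of_nonneg_right hDle hd0
    calc ‖v x'‖ ≤ C * g x' + D * d x' := hrep
      _ ≤ _ := by rw [mul_add]; linarith [t1, t2]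
  · -- (3): `u` alone
    obtain ⟨hgx, -, hdx, -⟩ := hsign x hx
    have hg0 : 0 ≤ g x := by linarith
    have hd0 : 0 ≤ d x := by linarith
    have hrep : ‖u x‖ ≤ A * g x + B * d x := by
      rw [(hU x hx).1]; exact norm_mul_ofReal_add_le au bu hg0 hd0
    have t1 : A * g x ≤ Wn * (2 * Q₁ * g x / (|Fv| * w₀)) := by
      have e : Wn * (2 * Q₁ * g x / (|Fv| * w₀)) = (Wn * (2 * Q₁ / (|Fv| * w₀))) * g x := by
        field_simp
      rw [e]
      exact mul_le_mul_of_nonneg_right hAle hg0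
    have t2 : B * d x ≤ Wn * (2 * P₁ ^ 2 * Q₁ * d x / (|Fu| * |Fv| * w₀ ^ 2)) := by
      have e : Wn * (2 * P₁ ^ 2 * Q₁ * d x / (|Fu| * |Fv| * w₀ ^ 2)) =
          (P₁ / w₀) * (Wn * (2 * P₁ * Q₁ / (|Fu| * |Fv| * w₀))) * d x := by
        field_simp
      rw [e]
      refine mul_le_mul_of_nonneg_right ?_ hd0
      calc B = B * 1 := (mul_one _).symm
        _ ≤ (P₁ / w₀) * (Wn * (2 * P₁ * Q₁ / (|Fu| * |Fv| * w₀))) :=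
            mul_le_mul hBle h4' zero_le_one (by positivity)
    calc ‖u x‖ ≤ A * g x + B * d x := hrep
      _ ≤ _ := by rw [mul_add]; linarith [t1, t2]

end Literature.Analysis.ODE

end
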